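import Summits.Ventures.Crystal3D.Theorems.StickyWulffConstantTextureLiminfTexShadowCoverageBarlowAtDefs
import HarnessLib

/-!
# TexShadow row (e) / EDGE-ON option (ε): the one-sided coverage certificate over the STEERED family menu
# (lane T, crux `TextureLiminfV5`, stmt-Ventures-23912, sub-crux EDGE-ON `stub_edgeOn`; cf-p1 DECISION (ciii)(2); HOME/wall-p2-g11/EPSILON-SIZING.md)

HONEST FRAMING. Venture `Summits/Ventures/Crystal3D` (cell `crystal3d-full`), route `route-Ventures-StickyWulffConstant`, helper
`--supports` the law-v5 crux `TextureLiminfV5` (stmt-Ventures-23912), registered line `TexShadow` v8.3, stubs `stub_coverageBarlow` / `stub_edgeOn`.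
DEFINITIONS ONLY (+ inclusions); no certificate is asserted; rung F-C1 not moved.

THE POINT.  `…CoverageBarlowDefs` / `…CoverageBarlowAtDefs` type the K3 per-box verdict over the `±e₃`-STEERED families (canonical and chosen slots).  On plates
tilted beyond `DeltaSteep` no up-slot is `e₃`-steep (EDGE-ON-MEMO §EO-1): the STEERED Barlow family of lane G's K1b (`barlow_hlines_oriented_oneSided_at_tilt` /
`…_top_at_tilt`: a unit steering `z` within `1/4` of `±e₃`, launch slot steep FOR `z`, `z`-best ∇-cappers, window in `e₃`-heights — `…Barlow*Tilt` files)
launches from any up-slot of `e₃`-rise ≥ 0.51.  This file types the corresponding family certificates and menu: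
* **`BarlowUpCertifiedSteer c₀ σ₁ L₁ L₂ z v`** — `‖z‖ = 1`, `‖z − e₃‖ ≤ 1/4`, `v` a reference up-slot of plate 1's up-presentation steep for `z`, Δ-strip `e₃`-rise
  `⟪L₁' v, e₃⟫ ≥ √2·c₀`, ∇-strip: the `z`-capper's `e₃`-rise `≥ 1/4` and `≥ √2·c₀` (only if the up-word has ∇-bilayers), and clause (i) for `chainFrames z L₁' v`
  (`L₁' = upFrame L₁ e₃`); **`BarlowDownCertifiedSteer`** — the mirror for plate 2 toward `−e₃`;
* **`BarlowMenuSteerCertified`** := `BarlowMenuCertified ∨ ∃ z v, UpSteer ∨ ∃ z v, DownSteer`; schema **`ResidualSteerCoverageBarlowOn Reg c₀`**; inclusions.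
WHAT THIS IS NOT: no certificate; tilts beyond `1/4` (the `1/3` toolkit) not typed here; F-C1 not moved.
-/

noncomputable section

open scoped BigOperators InnerProductSpace ENNReal
open MeasureTheory Filter

namespace Summit.Ventures.Crystal3D.Cruxes.TextureLiminf.TexShadow

open Summit.Ventures.Crystal3D Summit.Ventures.Crystal3D.Theorems
open Literature.MathematicalPhysics.StatisticalMechanics (IsHaggSeq fccStacking barlowStacking basalMirror)

/-! ## Steered family certificates -/

/-- **UP family of plate 1, chosen slot `v`, STEERING `z` (‖z − e₃‖ ≤ 1/4), certified at charge `c₀`** (= the hypotheses of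
`barlow_hlines_oriented_oneSided_at_tilt` for the up-presentation `upFrame L₁ e₃` + test (γ) on both strip types). -/
def BarlowUpCertifiedSteer (c₀ : ℝ) (σ₁ : ℤ → ℤ) (L₁ L₂ : E3 ≃ₗᵢ[ℝ] E3) (z v : E3) : Prop :=
  ‖z‖ = 1 ∧ ‖z - e₃‖ ≤ 1 / 4 ∧ v ∈ fccSlots ∧ v 2 = Real.sqrt (2 / 3) ∧
    Real.sqrt 2 / 2 ≤ ⟪upFrame L₁ e₃ v, z⟫_ℝ ∧ Real.sqrt 2 * c₀ ≤ ⟪upFrame L₁ e₃ v, e₃⟫_ℝ ∧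
    (∀ i : ℤ, upWord L₁ σ₁ e₃ i = -1 →
      (1 / 4 : ℝ) ≤ ⟪upFrame L₁ e₃ (basalMirror (bestCapper (twinFrame (upFrame L₁ e₃) (upFrame L₁ e₃ e₃)) (upFrame L₁ e₃ e₃) z)), e₃⟫_ℝ ∧
      Real.sqrt 2 * c₀ ≤
        ⟪upFrame L₁ e₃ (basalMirror (bestCapper (twinFrame (upFrame L₁ e₃) (upFrame L₁ e₃ e₃)) (upFrame L₁ e₃ e₃) z)), e₃⟫_ℝ) ∧
    ∀ F ∈ chainFrames z (upFrame L₁ e₃) v,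
      F '' fccStacking 1 (Real.sqrt (2 / 3)) ≠ L₂ '' fccStacking 1 (Real.sqrt (2 / 3)) ∧
      F '' fccStacking 1 (Real.sqrt (2 / 3)) ≠ (twinFrame L₂ (L₂ e₃)) '' fccStacking 1 (Real.sqrt (2 / 3))

/-- **DOWN family of plate 2, chosen slot `v`, STEERING `z` (‖z + e₃‖ ≤ 1/4), certified at charge `c₀`** (`barlow_hlines_oriented_oneSided_top_at_tilt`). -/
def BarlowDownCertifiedSteer (c₀ : ℝ) (σ₂ : ℤ → ℤ) (L₁ L₂ : E3 ≃ₗᵢ[ℝ] E3) (z v : E3) : Prop :=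
  ‖z‖ = 1 ∧ ‖z - (-e₃)‖ ≤ 1 / 4 ∧ v ∈ fccSlots ∧ v 2 = Real.sqrt (2 / 3) ∧
    Real.sqrt 2 / 2 ≤ ⟪upFrame L₂ (-e₃) v, z⟫_ℝ ∧ Real.sqrt 2 * c₀ ≤ ⟪upFrame L₂ (-e₃) v, -e₃⟫_ℝ ∧
    (∀ j : ℤ, upWord L₂ σ₂ (-e₃) j = -1 →
      (1 / 4 : ℝ) ≤ ⟪upFrame L₂ (-e₃) (basalMirror (bestCapper (twinFrame (upFrame L₂ (-e₃)) (upFrame L₂ (-e₃) e₃))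
        (upFrame L₂ (-e₃) e₃) z)), -e₃⟫_ℝ ∧
      Real.sqrt 2 * c₀ ≤ ⟪upFrame L₂ (-e₃) (basalMirror (bestCapper (twinFrame (upFrame L₂ (-e₃)) (upFrame L₂ (-e₃) e₃))
        (upFrame L₂ (-e₃) e₃) z)), -e₃⟫_ℝ) ∧
    ∀ F ∈ chainFrames z (upFrame L₂ (-e₃)) v,
      F '' fccStacking 1 (Real.sqrt (2 / 3)) ≠ L₁ '' fccStacking 1 (Real.sqrt (2 / 3)) ∧
      F '' fccStacking 1 (Real.sqrt (2 / 3)) ≠ (twinFrame L₁ (L₁ e₃)) '' fccStacking 1 (Real.sqrt (2 / 3))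

/-- **Certified over the STEERED menu**: the `±e₃`-steered menu, or some steered UP family of plate 1, or some steered DOWN family of plate 2. -/
def BarlowMenuSteerCertified (c₀ : ℝ) (σ₁ σ₂ : ℤ → ℤ) (L₁ L₂ : E3 ≃ₗᵢ[ℝ] E3) : Prop :=
  BarlowMenuCertified c₀ σ₁ σ₂ L₁ L₂ ∨ (∃ z v : E3, BarlowUpCertifiedSteer c₀ σ₁ L₁ L₂ z v) ∨
    (∃ z v : E3, BarlowDownCertifiedSteer c₀ σ₂ L₁ L₂ z v)

/-! ## The steered certificate schema -/

/-- **THE ONE-SIDED BARLOW COVERAGE CERTIFICATE ON `Reg`, STEERED MENU** (schema): every faulted Hägg pair of presented plates in `Reg` is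
steer-menu-certified at `c₀`. -/
def ResidualSteerCoverageBarlowOn (Reg : (ℤ → ℤ) → (ℤ → ℤ) → (E3 ≃ₗᵢ[ℝ] E3) → (E3 ≃ₗᵢ[ℝ] E3) → Prop) (c₀ : ℝ) : Prop :=
  ∀ (σ₁ σ₂ : ℤ → ℤ), IsHaggSeq σ₁ → IsHaggSeq σ₂ → ¬ BothFcc σ₁ σ₂ →
    ∀ (L₁ L₂ : E3 ≃ₗᵢ[ℝ] E3), Reg σ₁ σ₂ L₁ L₂ → BarlowMenuSteerCertified c₀ σ₁ σ₂ L₁ L₂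

/-! ## Inclusions -/

/-- A menu certificate is a steered-menu certificate. -/
theorem steerCoverageBarlowOn_of_menuCoverageBarlowOn {Reg : (ℤ → ℤ) → (ℤ → ℤ) → (E3 ≃ₗᵢ[ℝ] E3) → (E3 ≃ₗᵢ[ℝ] E3) → Prop} {c₀ : ℝ}
    (h : ResidualMenuCoverageBarlowOn Reg c₀) : ResidualSteerCoverageBarlowOn Reg c₀ :=
  fun σ₁ σ₂ hσ₁ hσ₂ hf L₁ L₂ hreg => Or.inl (h σ₁ σ₂ hσ₁ hσ₂ hf L₁ L₂ hreg)

/-- A canonical certificate is a steered-menu certificate. -/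
theorem steerCoverageBarlowOn_of_coverageBarlowOn {Reg : (ℤ → ℤ) → (ℤ → ℤ) → (E3 ≃ₗᵢ[ℝ] E3) → (E3 ≃ₗᵢ[ℝ] E3) → Prop} {c₀ : ℝ}
    (h : ResidualOneSidedCoverageBarlowOn Reg c₀) : ResidualSteerCoverageBarlowOn Reg c₀ :=
  steerCoverageBarlowOn_of_menuCoverageBarlowOn (menuCoverageBarlowOn_of_coverageBarlowOn h)

/-- Steered certificates restrict along implications of regimes. -/
theorem steerCoverageBarlowOn_mono {Reg Reg' : (ℤ → ℤ) → (ℤ → ℤ) → (E3 ≃ₗᵢ[ℝ] E3) → (E3 ≃ₗᵢ[ℝ] E3) → Prop}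
    (hle : ∀ σ₁ σ₂ L₁ L₂, Reg' σ₁ σ₂ L₁ L₂ → Reg σ₁ σ₂ L₁ L₂) {c₀ : ℝ} (h : ResidualSteerCoverageBarlowOn Reg c₀) :
    ResidualSteerCoverageBarlowOn Reg' c₀ :=
  fun σ₁ σ₂ hσ₁ hσ₂ hf L₁ L₂ hreg => h σ₁ σ₂ hσ₁ hσ₂ hf L₁ L₂ (hle σ₁ σ₂ L₁ L₂ hreg)

end Summit.Ventures.Crystal3D.Cruxes.TextureLiminf.TexShadow

end
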